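import Summits.SmoothPoincare4.SmoothPoincare4.Theorems.ConvexBisectionAcyclicBisectionExistsGluingRelMapZero
import Literature.AlgebraicTopology.SingularHomology.RelativeKroneckerAbsolute
import Literature.AlgebraicTopology.SingularHomology.UniversalCoefficientsField
import HarnessLib

/-!
# `Hᵏ(A, ∂A; F) → Hᵏ(A; F)` vanishes for a piece `A` of a boundary gluing `M = A ∪_φ B` with
# `Hₖ(M; F) = 0` (field coefficients)
(cohomological twin of brick D7 of stub `stub_modelsOnFibred_balance` (NF3), line `modp-braid-orbits`,
reshape r11, crux `ConvexBisection.AcyclicBisectionExists`, item stmt-SmoothPoincare4-10508)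

The landed brick `ofAbsolute_boundary_eq_zero_of_isBoundaryGluing`
(`…GluingRelMapZero.lean`): for a boundary gluing `M = A ∪_φ B` with `Hₖ(M) = 0` the map
`j_* : Hₖ(A) → Hₖ(A, ∂A)` is zero.  Over a FIELD `F` the Kronecker pairings are perfect, and
`⟨j^* x, c⟩ = ⟨x, j_* c⟩ = 0` (tree `kroneckerPairing_toAbsolute`, Hatcher §3.1 p. 200–201), so the
dual map **`j^* : Hᵏ(A, ∂A; F) → Hᵏ(A; F)` is zero as well** (`kroneckerPairing_injective_of_field`):
`helper_toAbsolute_boundary_eq_zero_of_isBoundaryGluing`.  Equivalently the restriction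
`Hᵏ(A; F) → Hᵏ(∂A; F)` is injective.

This is the form consumed by the characteristic-number bookkeeping of Etnyre–Fuller 2006 (eq. (d3),
p. 7) / Gompf 1998 (Def. 4.2) for the Lefschetz handlebody `X` of a fibred model of a rational
homology 4-sphere: a lift `c̃ ∈ H²(X, ∂X; ℚ)` of `c₁(X)` has `j^* c̃ = c₁(X)_ℚ = 0`, so
`c²(X) = ⟨c̃ ⌣ j^* c̃, [X, ∂X]⟩ = 0`, and the relative cup form of `(X, ∂X)` vanishes (`σ(X) = 0`).

Everything is proved from tree theorems; no definitions, no named facts, no `sorry`.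

## References

* A. Hatcher, *Algebraic Topology*, CUP 2002, §3.1 Thm. 3.2 and pp. 198–201. [HatcherAT2002]
* J. Etnyre, T. Fuller, *Realizing 4-manifolds as achiral Lefschetz fibrations*, IMRN 2006,
  eq. (d3) p. 7. [EtnyreFuller2006]
-/

noncomputable section

-- the prescribed namespace `Summit.<P>.<Sub>.…` duplicates `SmoothPoincare4` (P = Sub)
set_option linter.dupNamespace false

open scoped Manifold ContDiff Topology
open Set Function CategoryTheory CategoryTheory.Limits
open Literature.AlgebraicTopology.SingularHomology Literature.Topology.FourManifolds

namespace Summit.SmoothPoincare4.SmoothPoincare4.Theorems.AcyclicBisectionExists.ModpBraidOrbits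

section Pieces

variable {M : Type} [TopologicalSpace M] [T2Space M] [ChartedSpace (EuclideanSpace ℝ (Fin 4)) M]
  [IsManifold (𝓡 4) ∞ M]
  {A : Type} [TopologicalSpace A] [T2Space A] [SecondCountableTopology A] [CompactSpace A]
  [ChartedSpace (EuclideanHalfSpace 4) A] [IsManifold (𝓡∂ 4) ∞ A]
  {B : Type} [TopologicalSpace B] [T2Space B] [SecondCountableTopology B] [CompactSpace B]
  [ChartedSpace (EuclideanHalfSpace 4) B] [IsManifold (𝓡∂ 4) ∞ B]
  {F : Type} [Field F]

omit [T2Space M] [ChartedSpace (EuclideanSpace ℝ (Fin 4)) M] [IsManifold (𝓡 4) ∞ M] [T2Space A]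
  [SecondCountableTopology A] [CompactSpace A] [ChartedSpace (EuclideanHalfSpace 4) A]
  [IsManifold (𝓡∂ 4) ∞ A] in
/-- **`j_* = 0 ⇒ j^* = 0` over a field.**  If `j_* : Hₖ(A; F) → Hₖ(A, S; F)` vanishes then so does
`j^* : Hᵏ(A, S; F) → Hᵏ(A; F)`: `⟨j^* x, c⟩ = ⟨x, j_* c⟩ = 0` for all `c` (Hatcher §3.1 p. 200–201,
tree `kroneckerPairing_toAbsolute`) and the Kronecker map `Hᵏ(A; F) → Hom(Hₖ(A; F), F)` is
injective (tree `kroneckerPairing_injective_of_field`). [cite: HatcherAT2002, §3.1 Thm. 3.2 and pp. 198–201] -/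
theorem toAbsolute_eq_zero_of_ofAbsolute_eq_zero (S : Set A) {k : ℕ}
    (h : relativeSingularHomology.ofAbsolute F F A S k = 0) :
    relSingularCohomology.toAbsolute F F A S k = 0 := by
  ext x
  refine kroneckerPairing_injective_of_field F A k (LinearMap.ext fun c => ?_)
  rw [kroneckerPairing_toAbsolute, h]
  simp

/-- **`Hᵏ(A, ∂A; F) → Hᵏ(A; F)` is zero for the first piece of a boundary gluing `M = A ∪_φ B` with
`Hₖ(M; F) = 0`**, `F` a field (dual of `ofAbsolute_boundary_eq_zero_of_isBoundaryGluing`).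
[cite: HatcherAT2002, §3.1 pp. 198–201 and §2.1 Thm. 2.20] -/
theorem toAbsolute_boundary_eq_zero_of_isBoundaryGluing (bA : BoundaryData (𝓡∂ 4) A (𝓡 3))
    (bB : BoundaryData (𝓡∂ 4) B (𝓡 3)) (φ : bA.carrier ≃ₘ⟮𝓡 3, 𝓡 3⟯ bB.carrier)
    (h : IsBoundaryGluing bA bB φ (𝓡 4) M) {k : ℕ} (hk : IsZero (singularHomology F F M k)) :
    relSingularCohomology.toAbsolute F F A ((𝓡∂ 4).boundary A) k = 0 :=
  toAbsolute_eq_zero_of_ofAbsolute_eq_zero _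
    (ofAbsolute_boundary_eq_zero_of_isBoundaryGluing bA bB φ h hk)

/-- **The restriction `Hᵏ(A; F) → Hᵏ(∂A; F)` is injective** for the first piece of a boundary gluing
`M = A ∪_φ B` with `Hₖ(M; F) = 0`, `F` a field (exactness of `Hᵏ(A, ∂A) → Hᵏ(A) → Hᵏ(∂A)` and
`j^* = 0`). [cite: HatcherAT2002, §3.1 p. 200 and §2.1 Thm. 2.20] -/
theorem mono_cohomologyMap_boundary_of_isBoundaryGluing (bA : BoundaryData (𝓡∂ 4) A (𝓡 3))
    (bB : BoundaryData (𝓡∂ 4) B (𝓡 3)) (φ : bA.carrier ≃ₘ⟮𝓡 3, 𝓡 3⟯ bB.carrier)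
    (h : IsBoundaryGluing bA bB φ (𝓡 4) M) {k : ℕ} (hk : IsZero (singularHomology F F M k)) :
    Mono (singularCohomology.map F F (subsetIncl ((𝓡∂ 4).boundary A)) k) :=
  (relSingularCohomology.exact_toAbsolute_map ((𝓡∂ 4).boundary A) k).mono_g
    (toAbsolute_boundary_eq_zero_of_isBoundaryGluing bA bB φ h hk)

end Pieces

/-! ## The registered bricks -/

/-- **Brick `helper_toAbsolute_boundary_eq_zero_of_isBoundaryGluing` of stub
`stub_modelsOnFibred_balance` (NF3)**: for a boundary gluing `M = A ∪_φ B` of compact smooth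
4-manifolds with boundary, a field `F` and a degree `k` with `Hₖ(M; F) = 0`, the map
`j^* : Hᵏ(A, ∂A; F) → Hᵏ(A; F)` is zero (Kronecker dual of `j_* = 0`).  For the Lefschetz handlebody
`X` of a fibred model of a rational homology 4-sphere (`k = 2`, `F = ℚ`): every rational relative
class dies in `H²(X; ℚ)`, so `c²(X) = 0` and `σ(X) = 0` in Etnyre–Fuller's eq. (d3).
[cite: HatcherAT2002, §3.1 pp. 198–201 and §2.1 Thm. 2.20] -/
theorem helper_toAbsolute_boundary_eq_zero_of_isBoundaryGluing :
    ∀ (M : Type) [TopologicalSpace M] [T2Space M] [ChartedSpace (EuclideanSpace ℝ (Fin 4)) M]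
      [IsManifold (𝓡 4) ∞ M]
      (A : Type) [TopologicalSpace A] [T2Space A] [SecondCountableTopology A] [CompactSpace A]
      [ChartedSpace (EuclideanHalfSpace 4) A] [IsManifold (𝓡∂ 4) ∞ A]
      (B : Type) [TopologicalSpace B] [T2Space B] [SecondCountableTopology B] [CompactSpace B]
      [ChartedSpace (EuclideanHalfSpace 4) B] [IsManifold (𝓡∂ 4) ∞ B]
      (bA : Literature.Topology.FourManifolds.BoundaryData (𝓡∂ 4) A (𝓡 3))
      (bB : Literature.Topology.FourManifolds.BoundaryData (𝓡∂ 4) B (𝓡 3))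
      (φ : bA.carrier ≃ₘ⟮𝓡 3, 𝓡 3⟯ bB.carrier),
      Literature.Topology.FourManifolds.IsBoundaryGluing bA bB φ (𝓡 4) M →
      ∀ (F : Type) [Field F] (k : ℕ),
        CategoryTheory.Limits.IsZero
          (Literature.AlgebraicTopology.SingularHomology.singularHomology F F M k) →
        Literature.AlgebraicTopology.SingularHomology.relSingularCohomology.toAbsolute F F A
          ((𝓡∂ 4).boundary A) k = 0 := by
  intro M _ _ _ _ A _ _ _ _ _ _ B _ _ _ _ _ _ bA bB φ h F _ k hk
  exact toAbsolute_boundary_eq_zero_of_isBoundaryGluing bA bB φ h hk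

/-- **Brick `helper_mono_cohomologyMap_boundary_of_isBoundaryGluing` of stub
`stub_modelsOnFibred_balance` (NF3)**: for a boundary gluing `M = A ∪_φ B` of compact smooth
4-manifolds with boundary, a field `F` and a degree `k` with `Hₖ(M; F) = 0`, the restriction
`Hᵏ(A; F) → Hᵏ(∂A; F)` is a monomorphism (classes of the piece are detected on the seam).
[cite: HatcherAT2002, §3.1 p. 200 and §2.1 Thm. 2.20] -/
theorem helper_mono_cohomologyMap_boundary_of_isBoundaryGluing :
    ∀ (M : Type) [TopologicalSpace M] [T2Space M] [ChartedSpace (EuclideanSpace ℝ (Fin 4)) M]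
      [IsManifold (𝓡 4) ∞ M]
      (A : Type) [TopologicalSpace A] [T2Space A] [SecondCountableTopology A] [CompactSpace A]
      [ChartedSpace (EuclideanHalfSpace 4) A] [IsManifold (𝓡∂ 4) ∞ A]
      (B : Type) [TopologicalSpace B] [T2Space B] [SecondCountableTopology B] [CompactSpace B]
      [ChartedSpace (EuclideanHalfSpace 4) B] [IsManifold (𝓡∂ 4) ∞ B]
      (bA : Literature.Topology.FourManifolds.BoundaryData (𝓡∂ 4) A (𝓡 3))
      (bB : Literature.Topology.FourManifolds.BoundaryData (𝓡∂ 4) B (𝓡 3))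
      (φ : bA.carrier ≃ₘ⟮𝓡 3, 𝓡 3⟯ bB.carrier),
      Literature.Topology.FourManifolds.IsBoundaryGluing bA bB φ (𝓡 4) M →
      ∀ (F : Type) [Field F] (k : ℕ),
        CategoryTheory.Limits.IsZero
          (Literature.AlgebraicTopology.SingularHomology.singularHomology F F M k) →
        CategoryTheory.Mono (Literature.AlgebraicTopology.SingularHomology.singularCohomology.map F F
          (Literature.AlgebraicTopology.SingularHomology.subsetIncl ((𝓡∂ 4).boundary A)) k) := by
  intro M _ _ _ _ A _ _ _ _ _ _ B _ _ _ _ _ _ bA bB φ h F _ k hk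
  exact mono_cohomologyMap_boundary_of_isBoundaryGluing bA bB φ h hk

end Summit.SmoothPoincare4.SmoothPoincare4.Theorems.AcyclicBisectionExists.ModpBraidOrbits

end
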